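import Mathlib
import Literature.MathematicalPhysics.StatisticalMechanics.BarlowStackingEnergy
import Summits.AtomisticToContinuum.Crystallization.Theorems.MinMeanCycleStackingLockBarlowEnergyIdentification
import Summits.AtomisticToContinuum.Crystallization.Theorems.ChargedEnergyGap.Negative.BlocksBound

/-!
# Route `NashClassCertificates`, crux `NashNearField` (stmt-AtomisticToContinuum-16827), line `birth`:
# pieces for the stub `stub_localSmoothCertificateOfCauchyBorn` (CBBC ⇒ LSC), II — periodic coboundaries
# (the inter-layer transfer)

In a Barlow stacking of a `p`-periodic word the site energies `e_m` are `p`-periodic in the layer index but NOT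
constant (dhcp: the `J₂` cost of a c-layer sits on its two neighbouring layers, worker audit B2_audit.md), while
the Cauchy–Born floor only controls their period average `ē = (1/p) Σ_{m<p} e_m ≥ e*`.  The local smooth
certificate is sitewise, so the layer-to-layer variation has to be carried by INTER-LAYER transfers: a bounded
`p`-periodic `w` with `e_m − e* = w m − w (m−1) + (ē − e*)`, i.e. after receiving `w (m−1)` from the layer below
and sending `w m` to the layer above every layer has the nonnegative calibrated excess `ē − e*`.  This is the
discrete cell problem for periodic sequences, landed here in general:

* `stub_periodicCoboundary` — every `p`-periodic real sequence is its mean plus the coboundary of a bounded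
  `p`-periodic sequence: `f n = w n − w (n − 1) + (Σ_{k<p} f k)/p`, `|w| ≤ 2 Σ_{k<p} |f k|`
  (`w n = Σ_{1 ≤ k ≤ n mod p} (f k − mean)`);
* `barlowSiteEnergy_add_period` — the site energies `barlowSiteEnergy V a h s m` of the stacking of a `p`-periodic
  word are `p`-periodic in the layer (any pair potential `V`, any spacings);
* `stub_barlowLayerCorrector` — hence `barlowSiteEnergy V a h s n − E = w n − w (n−1) + (p⁻¹ Σ_{m<p} barlowSiteEnergy − E)`
  with a bounded periodic inter-layer transfer `w`, for every constant `E`;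
* `stub_barlowLayerCorrectorLJ` — for Lennard-Jones and `E = e*` the leftover is the energy per particle of the
  periodic configuration minus `e*`, which is `≥ 0` (landed `energyPerParticle_barlow_eq_average` + `eStar_le`).

`[folklore]`.
-/

noncomputable section

open scoped BigOperators
open Literature.MathematicalPhysics.StatisticalMechanics

namespace Summit.AtomisticToContinuum.Crystallization.Theorems.NashClassCertificatesNashNearField

/-- A `p`-periodic sequence on `ℤ` only depends on the residue: `f n = f (n % p)`. [folklore] -/
theorem periodic_apply_emod {f : ℤ → ℝ} {p : ℕ} (hper : ∀ n : ℤ, f (n + p) = f n) (n : ℤ) :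
    f (n % (p : ℤ)) = f n := by
  have hP : Function.Periodic f (p : ℤ) := hper
  have h := (hP.int_mul (-(n / (p : ℤ)))) n
  rw [Int.emod_def]
  rw [show n - (p : ℤ) * (n / (p : ℤ)) = n + -(n / (p : ℤ)) * (p : ℤ) by ring]
  exact h

/-- **Stub piece `stub_periodicCoboundary`: periodic sequences are mean plus a bounded periodic coboundary
(proved).**  For a `p`-periodic `f : ℤ → ℝ` (`0 < p`) there is a `p`-periodic `w` with
`|w n| ≤ 2 Σ_{k<p} |f k|` and `f n = w n − w (n − 1) + (Σ_{k<p} f k)/p` for every `n`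
(`w n = Σ_{1 ≤ k ≤ n mod p} (f k − mean)`, the partial sums of the mean-free part).  Applied to the layer site
energies `m ↦ e_m − e*` of a periodic (or periodised) stacking this is the inter-layer transfer of the local smooth
certificate: every layer is left with the period average `ē − e* ≥ 0`. [folklore] -/
theorem stub_periodicCoboundary :
    ∀ (f : ℤ → ℝ) (p : ℕ), 0 < p → (∀ n : ℤ, f (n + p) = f n) →
      ∃ w : ℤ → ℝ, (∀ n : ℤ, w (n + p) = w n) ∧ (∀ n : ℤ, |w n| ≤ 2 * ∑ k ∈ Finset.range p, |f k|) ∧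
        ∀ n : ℤ, f n = w n - w (n - 1) + (∑ k ∈ Finset.range p, f k) / p := by
  intro f p hp hper
  obtain ⟨q, rfl⟩ : ∃ q : ℕ, p = q + 1 := ⟨p - 1, by omega⟩
  set c : ℝ := (∑ k ∈ Finset.range (q + 1), f k) / ((q + 1 : ℕ) : ℝ) with hcdef
  -- partial sums of the mean-free part, read on the residue
  set S : ℕ → ℝ := fun r => ∑ k ∈ Finset.range r, (f ((k : ℤ) + 1) - c) with hSdef
  have hp0 : (0 : ℤ) < ((q + 1 : ℕ) : ℤ) := by exact_mod_cast hp
  have hpR : (0 : ℝ) < ((q + 1 : ℕ) : ℝ) := by exact_mod_cast hp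
  -- the mean identity `Σ_{k<p} f k = p c`, and the split `Σ_{k<p} f k = f 0 + Σ_{k<q} f (k+1)`
  have hsumc : ∑ k ∈ Finset.range (q + 1), f k = ((q + 1 : ℕ) : ℝ) * c := by
    rw [hcdef, mul_div_cancel₀ _ hpR.ne']
  have hsplit : ∑ k ∈ Finset.range (q + 1), f k = (∑ k ∈ Finset.range q, f ((k : ℤ) + 1)) + f 0 := by
    rw [Finset.sum_range_succ']
    push_cast
    rfl
  -- residues
  have hres : ∀ n : ℤ, 0 ≤ n % ((q + 1 : ℕ) : ℤ) ∧ n % ((q + 1 : ℕ) : ℤ) < ((q + 1 : ℕ) : ℤ) := fun n =>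
    ⟨Int.emod_nonneg _ hp0.ne', Int.emod_lt_of_pos _ hp0⟩
  refine ⟨fun n => S (n % ((q + 1 : ℕ) : ℤ)).toNat, fun n => ?_, fun n => ?_, fun n => ?_⟩
  · -- periodicity
    simp only [Int.add_emod_right]
  · -- the bound
    obtain ⟨h0, h1⟩ := hres n
    set r : ℕ := (n % ((q + 1 : ℕ) : ℤ)).toNat with hrdef
    have hr : r < q + 1 := by
      have : (r : ℤ) = n % ((q + 1 : ℕ) : ℤ) := Int.toNat_of_nonneg h0
      omega
    simp only
    calc |S r| = |∑ k ∈ Finset.range r, (f ((k : ℤ) + 1) - c)| := rfl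
      _ ≤ ∑ k ∈ Finset.range r, |f ((k : ℤ) + 1) - c| := Finset.abs_sum_le_sum_abs _ _
      _ ≤ ∑ k ∈ Finset.range r, (|f ((k : ℤ) + 1)| + |c|) := Finset.sum_le_sum fun k _ => abs_sub _ _
      _ = (∑ k ∈ Finset.range r, |f ((k : ℤ) + 1)|) + r * |c| := by
          rw [Finset.sum_add_distrib, Finset.sum_const, Finset.card_range, nsmul_eq_mul]
      _ ≤ (∑ k ∈ Finset.range q, |f ((k : ℤ) + 1)|) + ((q + 1 : ℕ) : ℝ) * |c| := by
          have h2 : ∑ k ∈ Finset.range r, |f ((k : ℤ) + 1)| ≤ ∑ k ∈ Finset.range q, |f ((k : ℤ) + 1)| :=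
            Finset.sum_le_sum_of_subset_of_nonneg (Finset.range_mono (by omega)) fun _ _ _ => abs_nonneg _
          have h3 : (r : ℝ) * |c| ≤ ((q + 1 : ℕ) : ℝ) * |c| :=
            mul_le_mul_of_nonneg_right (by exact_mod_cast hr.le) (abs_nonneg c)
          linarith
      _ ≤ (∑ k ∈ Finset.range (q + 1), |f k|) + ∑ k ∈ Finset.range (q + 1), |f k| := by
          have h4 : ∑ k ∈ Finset.range (q + 1), |f k| = (∑ k ∈ Finset.range q, |f ((k : ℤ) + 1)|) + |f 0| := by
            rw [Finset.sum_range_succ']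
            push_cast
            rfl
          have h5 : ((q + 1 : ℕ) : ℝ) * |c| = |∑ k ∈ Finset.range (q + 1), f k| := by
            rw [hsumc, abs_mul, abs_of_pos hpR]
          have h6 := Finset.abs_sum_le_sum_abs (fun k : ℕ => f (k : ℤ)) (Finset.range (q + 1))
          have h7 := abs_nonneg (f 0)
          linarith
      _ = 2 * ∑ k ∈ Finset.range (q + 1), |f k| := by ring
  · -- the coboundary identity
    obtain ⟨h0, h1⟩ := hres n
    simp only
    have hrn : (((n % ((q + 1 : ℕ) : ℤ)).toNat : ℕ) : ℤ) = n % ((q + 1 : ℕ) : ℤ) := Int.toNat_of_nonneg h0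
    set r : ℕ := (n % ((q + 1 : ℕ) : ℤ)).toNat with hrdef
    have hr : r < q + 1 := by omega
    have hfn : f n = f (r : ℤ) := by rw [hrn, periodic_apply_emod hper]
    have hn : (r : ℤ) + ((q + 1 : ℕ) : ℤ) * (n / ((q + 1 : ℕ) : ℤ)) = n := by
      rw [hrn]; exact Int.emod_add_mul_ediv n _
    have hS0 : S 0 = 0 := by simp [hSdef]
    have hSsucc : ∀ m : ℕ, S (m + 1) = S m + (f ((m : ℤ) + 1) - c) := fun m => by
      simp only [hSdef, Finset.sum_range_succ]
    rcases Nat.eq_zero_or_pos r with hr0 | hrpos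
    · -- residue `0`: the predecessor has residue `q`
      have e1 : n - 1 = (q : ℤ) + ((q + 1 : ℕ) : ℤ) * (n / ((q + 1 : ℕ) : ℤ) - 1) := by
        have h := hn
        rw [hr0] at h
        push_cast at h ⊢
        linear_combination -h
      have hprev : ((n - 1) % ((q + 1 : ℕ) : ℤ)).toNat = q := by
        rw [e1, Int.add_mul_emod_self_left, Int.emod_eq_of_lt (Int.natCast_nonneg q) (by omega)]
        exact Int.toNat_natCast q
      have hSq : S q = (∑ k ∈ Finset.range q, f ((k : ℤ) + 1)) - q * c := by
        simp only [hSdef, Finset.sum_sub_distrib, Finset.sum_const, Finset.card_range, nsmul_eq_mul]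
      rw [hprev, hfn, hr0, hS0, hSq]
      push_cast at hsumc ⊢
      linarith [hsumc, hsplit]
    · -- residue `m + 1`: the predecessor has residue `m`
      obtain ⟨m, hm⟩ : ∃ m : ℕ, r = m + 1 := ⟨r - 1, by omega⟩
      have e1 : n - 1 = (m : ℤ) + ((q + 1 : ℕ) : ℤ) * (n / ((q + 1 : ℕ) : ℤ)) := by
        have h := hn
        rw [hm] at h
        push_cast at h ⊢
        linear_combination -h
      have hprev : ((n - 1) % ((q + 1 : ℕ) : ℤ)).toNat = m := by
        rw [e1, Int.add_mul_emod_self_left, Int.emod_eq_of_lt (Int.natCast_nonneg m) (by omega)]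
        exact Int.toNat_natCast m
      rw [hprev, hfn, hm, hSsucc m]
      push_cast
      ring

/-! ## The Barlow layer site energies are periodic in the layer -/

/-- Relative positions in the stacking of a `p`-periodic word are `p`-periodic in the base layer. [folklore] -/
theorem dist_barlowPos_add_period (a h : ℝ) {s : ℤ → ℤ} {p : ℕ} (hs : ∀ i, s (i + p) = s i)
    (m k i j : ℤ) :
    dist (barlowPos a h s (m + p) 0 0) (barlowPos a h s (m + p + k) i j) =
      dist (barlowPos a h s m 0 0) (barlowPos a h s (m + k) i j) := by
  rw [← Real.sqrt_sq (dist_nonneg (x := barlowPos a h s (m + p) 0 0) (y := barlowPos a h s (m + p + k) i j)),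
    ← Real.sqrt_sq (dist_nonneg (x := barlowPos a h s m 0 0) (y := barlowPos a h s (m + k) i j)),
    dist_barlowPos_sq, dist_barlowPos_sq, show m + (p : ℤ) + k = (m + k) + p by ring,
    haggLabel_add_period hs, haggLabel_add_period hs]
  push_cast
  ring_nf

/-- The in-layer case of `dist_barlowPos_add_period`. [folklore] -/
theorem dist_barlowPos_add_period_self (a h : ℝ) {s : ℤ → ℤ} {p : ℕ} (hs : ∀ i, s (i + p) = s i)
    (m i j : ℤ) :
    dist (barlowPos a h s (m + p) 0 0) (barlowPos a h s (m + p) i j) =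
      dist (barlowPos a h s m 0 0) (barlowPos a h s m i j) := by
  simpa using dist_barlowPos_add_period a h hs m 0 i j

/-- **The layer site energies of a periodic stacking are periodic**: for a `p`-periodic word,
`barlowSiteEnergy V a h s (m + p) = barlowSiteEnergy V a h s m` (any pair potential, any spacings). [folklore] -/
theorem barlowSiteEnergy_add_period (V : ℝ → ℝ) (a h : ℝ) {s : ℤ → ℤ} {p : ℕ} (hs : ∀ i, s (i + p) = s i)
    (m : ℤ) : barlowSiteEnergy V a h s (m + p) = barlowSiteEnergy V a h s m := by
  unfold barlowSiteEnergy
  simp only [sub_eq_add_neg, dist_barlowPos_add_period a h hs, dist_barlowPos_add_period_self a h hs]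

/-- **Stub piece `stub_barlowLayerCorrector`: the inter-layer transfer of a periodic stacking (proved).**  For the
stacking of a `p`-periodic word (any pair potential `V`, spacings `a, h`, constant `E`) there is a bounded
`p`-periodic `w : ℤ → ℝ` with `barlowSiteEnergy V a h s n − E = w n − w (n − 1) + (p⁻¹ Σ_{m<p} barlowSiteEnergy V a h s m − E)`
for every layer `n`, `|w n| ≤ 2 Σ_{m<p} |barlowSiteEnergy V a h s m − E|`: receiving `w (n−1)` from the layer below and
sending `w n` above leaves every layer with the period average. [folklore] -/
theorem stub_barlowLayerCorrector :
    ∀ (V : ℝ → ℝ) (a h E : ℝ) (s : ℤ → ℤ) (p : ℕ), 0 < p → (∀ i : ℤ, s (i + p) = s i) →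
      ∃ w : ℤ → ℝ, (∀ n : ℤ, w (n + p) = w n) ∧
        (∀ n : ℤ, |w n| ≤ 2 * ∑ m ∈ Finset.range p, |barlowSiteEnergy V a h s m - E|) ∧
        ∀ n : ℤ, barlowSiteEnergy V a h s n - E =
          w n - w (n - 1) + ((∑ m ∈ Finset.range p, barlowSiteEnergy V a h s m) / p - E) := by
  intro V a h E s p hp hs
  obtain ⟨w, hwper, hwbd, hwcob⟩ := stub_periodicCoboundary (fun n => barlowSiteEnergy V a h s n - E) p hp
    (fun n => by simp only [barlowSiteEnergy_add_period V a h hs])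
  refine ⟨w, hwper, hwbd, fun n => ?_⟩
  have hpR : (0 : ℝ) < (p : ℝ) := by exact_mod_cast hp
  have hmean : (∑ m ∈ Finset.range p, (barlowSiteEnergy V a h s m - E)) / p =
      (∑ m ∈ Finset.range p, barlowSiteEnergy V a h s m) / p - E := by
    rw [Finset.sum_sub_distrib, Finset.sum_const, Finset.card_range, nsmul_eq_mul, sub_div,
      mul_div_cancel_left₀ _ hpR.ne']
  rw [← hmean]
  exact hwcob n

/-- **Stub piece `stub_barlowLayerCorrectorLJ`: the inter-layer transfer, Lennard-Jones, calibrated at `e*`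
(proved).**  For the Lennard-Jones stacking of a `p`-periodic word with spacings `a, h > 0` there is a bounded
`p`-periodic inter-layer transfer `w` with
`barlowSiteEnergy V_LJ a h s n − e* = w n − w (n − 1) + (e(P) − e*)` for every layer `n`, `P` the periodic
configuration of the stacking, and the leftover `e(P) − e* ≥ 0` (landed energy identification
`energyPerParticle_barlow_eq_average` and floor `eStar_le`): sitewise, after the layer transfers, every site of a
periodic stacking sits at least at `e*`. [folklore] -/
theorem stub_barlowLayerCorrectorLJ :
    ∀ (a h : ℝ) (s : ℤ → ℤ) (p : ℕ) (ha : 0 < a) (hh : 0 < h) (hp : p ≠ 0) (hs : ∀ i : ℤ, s (i + p) = s i),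
      ∃ w : ℤ → ℝ, (∀ n : ℤ, w (n + p) = w n) ∧
        (∀ n : ℤ, |w n| ≤ 2 * ∑ m ∈ Finset.range p,
          |barlowSiteEnergy lennardJones a h s m - (⨅ Q : PeriodicConfiguration 3, Q.energyPerParticle lennardJones)|) ∧
        (∀ n : ℤ, barlowSiteEnergy lennardJones a h s n - (⨅ Q : PeriodicConfiguration 3, Q.energyPerParticle lennardJones) =
          w n - w (n - 1) +
            ((barlowPeriodicConfiguration s ha.ne' hh.ne' hp hs).energyPerParticle lennardJones -
              (⨅ Q : PeriodicConfiguration 3, Q.energyPerParticle lennardJones))) ∧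
        0 ≤ (barlowPeriodicConfiguration s ha.ne' hh.ne' hp hs).energyPerParticle lennardJones -
          (⨅ Q : PeriodicConfiguration 3, Q.energyPerParticle lennardJones) := by
  intro a h s p ha hh hp hs
  obtain ⟨w, hwper, hwbd, hwcob⟩ := stub_barlowLayerCorrector lennardJones a h
    (⨅ Q : PeriodicConfiguration 3, Q.energyPerParticle lennardJones) s p (Nat.pos_of_ne_zero hp) hs
  have havg := Summit.AtomisticToContinuum.Crystallization.Theorems.energyPerParticle_barlow_eq_average
    ha hh ha.ne' hh.ne' hp hs
  have hfloor : (⨅ Q : PeriodicConfiguration 3, Q.energyPerParticle lennardJones) ≤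
      (barlowPeriodicConfiguration s ha.ne' hh.ne' hp hs).energyPerParticle lennardJones :=
    ChargedEnergyGapNegative.eStar_le _
  refine ⟨w, hwper, hwbd, fun n => ?_, by linarith⟩
  rw [havg]
  exact hwcob n

end Summit.AtomisticToContinuum.Crystallization.Theorems.NashClassCertificatesNashNearField

end
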